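import Summits.HubbardSuperconductivity.HubbardSuperconductivity.Theorems.NodalWardXYDefs

/-!
# Milestone M2 for crux stmt-HubbardSuperconductivity-10739 `NodalWardXY.PerturbedXYOrder` (lead c17, 2026-08-17)

`CurrentVarianceXY3` — the `n = 2` instance of the cumulant form of the crux
(`perturbedXYOrder_iff_cumulantBounds`, p106870): **the variance of the two-current observable
`W_K` under the REAL low-temperature rotator state is extensive**, uniformly in the volume,
for every admissible kernel.  Necessary for the crux (it is one Taylor coefficient of
`log Z_L(tK)` at `t = 0`, `× L⁻³`); not sufficient.  Typed here (no proof, no `sorry`) as the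
cheapest statement on which a REAL-measure method could show that a volume-uniform low-temperature
expansion of the 3-D plane rotator is within reach (STRATEGY-CENSUS §Strengthen S5 typed M1 =
`LinearResponseXY3`, the mixed covariance with `|M|²`; M2 is its pure-current sibling and does not
involve the magnetisation).

Decomposition recorded in `HANDBACK-c17.md` §3: under the Hartman–Watson subordination
`e^{J cos x} = ∫ η_J(dτ) Σ_{m∈ℤ} g_τ(x + 2πm)` (von Mises = Brownian motion on the circle at an
independent random time) the rotator state is an annealed mixture of inhomogeneous Villain states,
each of which factorises into a Gaussian spin wave with bond conductances `1/τ_b` and a vortex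
2-form; by the law of total variance `Var W = E_env Var(W | env) + Var_env E(W | env)` and the
Gaussian Brascamp–Lieb inequality in `H⁻¹` form, the FIRST term is bounded by
`(288 ε)² · E[Σ_b τ_b] = O(ε² L³)` with NO decay analysis (the `ℓ²`-projection
`T^{1/2}D(DᵀTD)⁻¹DᵀT^{1/2}` absorbs the massless kernel); the SECOND term (fluctuations of the
local Gaussian expectations with the vortex configuration and the conductance environment) is the
entire difficulty and is where print stops (Adams–Kotecký–Müller needed a complete RG for the
analogous second-derivative statement — strict convexity of the surface tension — of a non-convex
gradient model at low temperature; Biskup–Spohn's Gaussian-mixture route is the one printed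
non-RG handle and is exactly the Hartman–Watson structure, but without vortices).
-/

noncomputable section

namespace Summit.HubbardSuperconductivity.HubbardSuperconductivity.Cruxes.PerturbedXYOrder

open MeasureTheory Literature.Probability.LatticeModels
open Summit.HubbardSuperconductivity.HubbardSuperconductivity.Theorems.PerturbedXYOrder

/-- **Milestone M2 (`CurrentVarianceXY3`).** There are `J₀`, `ε > 0`, `C` such that for all
`J ≥ J₀`, all `L ≥ 2` and every kernel `K` admissible at radius `ε`, the variance of
`W_K = Σ K(b,b') j_b j_{b'}` under the real rotator state `w_J dθ / Z_0` on `(ℤ/Lℤ)³` is at most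
`C · L³`:  `Z_0⁻¹ ∫ |W_K|² w_J − |Z_0⁻¹ ∫ W_K w_J|² ≤ C L³` (complex `W_K`; `|·|²` = squared modulus,
i.e. `Var Re W_K + Var Im W_K`).  Equivalently (Cauchy–Schwarz in the kernel is NOT enough — that
gives `L⁶`): summable decay of the truncated four-current function of the low-temperature rotator,
tested against `(1+dist)⁻⁴ ⊗ (1+dist)⁻⁴`.  The `n = 2` case of `stub_cumulantBounds` (p106870). -/
def CurrentVarianceXY3 : Prop :=
  ∃ J₀ ε C : ℝ, 0 < ε ∧ ∀ J : ℝ, J₀ ≤ J → ∀ (L : ℕ) [NeZero L], 2 ≤ L →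
    ∀ K : Bond L → Bond L → ℂ, Admissible L ε K →
      (∫ θ in cube L, ‖Wk K θ‖ ^ 2 * (wJ J θ).re) / (Zk J (0 : Bond L → Bond L → ℂ)).re
        - ‖(∫ θ in cube L, Wk K θ * wJ J θ) / Zk J (0 : Bond L → Bond L → ℂ)‖ ^ 2 ≤ C * (L : ℝ) ^ 3

end Summit.HubbardSuperconductivity.HubbardSuperconductivity.Cruxes.PerturbedXYOrder

end
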